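import Summits.QuantumFields.YangMills.Theses.CoincidenceRotationBootstrap
import Summits.QuantumFields.YangMills.Theorems.LangevinControlUVOSLegsFromFemtoAndGapStubUpgrade
import HarnessLib

/-!
# Route `CoincidenceRotationBootstrap` (YangMills): the assembly item (stmt-QuantumFields-16321) holds

`CurvatureAmnesia → HypercubicLimit → YangMills` is the route's deciding theorem `closes` once its third hypothesis, the
density upgrade `EuclideanUpgrade` (item stmt-QuantumFields-8647, closed), is supplied: that decl is VERBATIM the body of
`ScalingWindowSplit.EuclideanUpgrade` and is proved by the landed stub `DlrCollarTransfer.stub_upgrade` (same term as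
`ScalingWindowSplit.euclideanUpgrade_proof`).  Pure logic; the cruxes `CurvatureAmnesia`, `HypercubicLimit` remain open; no
summit statement is proved (width seat ym-t4-w17 g0, free hands).
-/

set_option autoImplicit false

namespace Summit.QuantumFields.YangMills.Theorems

/-- The route's `EuclideanUpgrade` (density upgrade) by the landed `stub_upgrade`. [folklore] -/
theorem coincidenceRotationBootstrap_euclideanUpgrade :
    Summit.QuantumFields.YangMills.Theses.CoincidenceRotationBootstrap.EuclideanUpgrade := by
  unfold Summit.QuantumFields.YangMills.Theses.CoincidenceRotationBootstrap.EuclideanUpgrade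
  exact Summit.QuantumFields.YangMills.Cruxes.OSLegsFromFemtoAndGap.DlrCollarTransfer.stub_upgrade

/-- **Item stmt-QuantumFields-16321 `CoincidenceRotationBootstrap.Assembly` holds.** [folklore] -/
theorem coincidenceRotationBootstrap_assembly_proof :
    Summit.QuantumFields.YangMills.Theses.CoincidenceRotationBootstrap.Assembly :=
  fun h₁ h₂ => Summit.QuantumFields.YangMills.Theses.CoincidenceRotationBootstrap.closes h₁ h₂
    coincidenceRotationBootstrap_euclideanUpgrade

end Summit.QuantumFields.YangMills.Theorems
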